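import Summits.KontsevichZagierPeriods.KontsevichZagierPeriods.Theorems.UnfoldedStokesStokesGenerationStubLoopAngleExp
import Literature.NumberTheory.Transcendental.SemialgebraicAlgebraicPoints
import Mathlib.MeasureTheory.Integral.IntervalIntegral.FundThmCalculus
import Mathlib.Analysis.SpecialFunctions.ExpDeriv
import Mathlib.Analysis.Complex.RealDeriv
import Mathlib.RingTheory.Algebraic.Basic
import Mathlib.FieldTheory.AlgebraicClosure

/-!
# `StokesGeneration` (stmt-KontsevichZagierPeriods-3586) — line `fibrewise_stokes`, stub `stub_saLoopAngleExp`

Registered rung stub X3 (rung 10) of the line `fibrewise_stokes` of the crux `StokesGeneration`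
(route UnfoldedStokes): **the exponential of the total angle of a semialgebraic `C¹` loop is
algebraic**.

For a complex loop `P = A + iB` on `[0,1]` (`A`, `B` real, continuous on `[0,1]`, differentiable on
`(0,1)` with derivatives `A'`, `B'` continuous on `[0,1]`, and `ℚ`-semialgebraic on the unit cube of
`ℝ¹`) without zeros on `[0,1]`, the total angle is
`Θ = ∫₀¹ Im (P'/P) = ∫₀¹ (A B' − A' B)/(A² + B²)`, and `e^{iΘ}` is an algebraic number: it is the unit
vector `(P(1)/|P(1)|)/(P(0)/|P(0)|)`, and the endpoint values `A(0), A(1), B(0), B(1)` are algebraic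
(values of `ℚ`-semialgebraic functions at rational points, `IsSemialgebraicFunOn.isAlgebraic_apply`).

Proof. Let `T(x) = ∫₀ˣ (A B' − A' B)/(A² + B²)` (so `T' = Im (P'/P)` on `(0,1)` by FTC-1) and
`g(x) = conj(P(x)) · e^{2iT(x)} / P(x)`. Since
`(conj P/P)'/(conj P/P) = conj(P')/conj(P) − P'/P = −2i·Im(P'/P)`, the derivative of `g` vanishes
on `(0,1)`; `g` is continuous on `[0,1]`, so `g(1) = g(0)` (FTC-2 with zero derivative), i.e.
`e^{2iΘ} = conj(P(0)) P(1) / (P(0) conj(P(1)))`, an element of the field `ℚ̄ ∩ ℂ` of algebraic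
numbers (`i² = −1`). Hence `(e^{iΘ})² = e^{2iΘ}` is algebraic and so is `e^{iΘ}`. This is the
polynomial-loop argument of `…StubLoopAngleExp.lean` (rung 8, W1), whose FTC helpers are reused,
with derivatives on the open interval only.

References: M. Kontsevich, D. Zagier, *Periods* (2001), §1.1–1.2 (`π` and arguments of algebraic
numbers as periods; the Stokes/Newton–Leibniz rule); J. Bochnak, M. Coste, M.-F. Roy, *Real Algebraic
Geometry* (1998), §2.1–2.2 (values of semialgebraic functions over the field of definition); the
computation itself is folklore calculus.
-/

noncomputable section

set_option linter.dupNamespace false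

namespace Summit.KontsevichZagierPeriods.KontsevichZagierPeriods.Cruxes.StokesGeneration.FibrewiseStokes

open MeasureTheory Set Literature.NumberTheory.Transcendental Literature.NumberTheory.Transcendental.KZ
open Literature.ModelTheory.ExponentialFields (IsSemialgebraic)
open Complex (I exp)

/-- Continuity of the angular integrand `Im (P'/P) = (A B' − A' B)/(A² + B²)` of the loop
`P = A + iB` (with `A, B, A', B'` continuous on `t`) on a set `t` where `A² + B²` does not vanish.
[folklore] -/
theorem saLoopAngle_integrand_continuousOn {A B A' B' : ℝ → ℝ} {t : Set ℝ}
    (hA : ContinuousOn A t) (hB : ContinuousOn B t) (hA' : ContinuousOn A' t)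
    (hB' : ContinuousOn B' t) (hne : ∀ u ∈ t, A u ^ 2 + B u ^ 2 ≠ 0) :
    ContinuousOn (fun u => (A u * B' u - A' u * B u) / (A u ^ 2 + B u ^ 2)) t := by
  refine ContinuousOn.div ?_ ?_ hne
  · exact (hA.mul hB').sub (hA'.mul hB)
  · exact (hA.pow 2).add (hB.pow 2)

/-- **The rotating frame is constant (derivative).** For the loop `P = A + iB` with
`A' (x) = a'`, `B'(x) = b'`, and any real function `T` with `T'(x) = w`,
`w · (A² + B²)(x) = (A b' − a' B)(x)` and `(A² + B²)(x) ≠ 0`, the function `conj(P) · e^{2iT} / P`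
has zero derivative at `x` (`conj(P)'/conj(P) − P'/P = −2i Im(P'/P)`). [folklore] -/
theorem saLoopAngle_frame_hasDerivAt {A B T : ℝ → ℝ} {a' b' w x : ℝ}
    (hA : HasDerivAt A a' x) (hB : HasDerivAt B b' x) (hT : HasDerivAt T w x)
    (hw : w * (A x ^ 2 + B x ^ 2) = A x * b' - a' * B x)
    (hx : A x ^ 2 + B x ^ 2 ≠ 0) :
    HasDerivAt (fun y : ℝ => (((A y : ℝ) : ℂ) - ((B y : ℝ) : ℂ) * I) *
        exp (2 * ((T y : ℝ) : ℂ) * I) / (((A y : ℝ) : ℂ) + ((B y : ℝ) : ℂ) * I))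
      0 x := by
  have hAc : HasDerivAt (fun y : ℝ => ((A y : ℝ) : ℂ)) ((a' : ℝ) : ℂ) x := hA.ofReal_comp
  have hBc : HasDerivAt (fun y : ℝ => ((B y : ℝ) : ℂ)) ((b' : ℝ) : ℂ) x := hB.ofReal_comp
  have hP := hAc.fun_add (hBc.mul_const I)
  have hPbar := hAc.fun_sub (hBc.mul_const I)
  have hE := ((hT.ofReal_comp.const_mul (2:ℂ)).mul_const I).cexp
  have hg := (hPbar.fun_mul hE).fun_div hP (loopAngle_point_ne_zero hx)
  refine hg.congr_deriv ?_
  have hPP : (((A x : ℝ) : ℂ) + ((B x : ℝ) : ℂ) * I) * (((A x : ℝ) : ℂ) - ((B x : ℝ) : ℂ) * I)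
      = ((A x : ℝ) : ℂ) ^ 2 + ((B x : ℝ) : ℂ) ^ 2 := by
    linear_combination (-(((B x : ℝ) : ℂ)) ^ 2) * Complex.I_sq
  have hwC : (w : ℂ) * (((A x : ℝ) : ℂ) ^ 2 + ((B x : ℝ) : ℂ) ^ 2) =
      ((A x : ℝ) : ℂ) * ((b' : ℝ) : ℂ) - ((a' : ℝ) : ℂ) * ((B x : ℝ) : ℂ) := by
    exact_mod_cast hw
  rw [div_eq_zero_iff]
  left
  linear_combination (2 * exp (2 * ((T x : ℝ) : ℂ) * I) * (w : ℂ) * I) * hPP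
    + (2 * exp (2 * ((T x : ℝ) : ℂ) * I) * I) * hwC

/-- **The rotating frame is constant (continuity).** For the loop `P = A + iB` continuous and
without zeros on `[0,1]` and `T` continuous on `[0,1]`, the function `conj(P) · e^{2iT} / P` is
continuous on `[0,1]`. [folklore] -/
theorem saLoopAngle_frame_continuousOn {A B T : ℝ → ℝ}
    (hA : ContinuousOn A (Icc (0:ℝ) 1)) (hB : ContinuousOn B (Icc (0:ℝ) 1))
    (hT : ContinuousOn T (Icc (0:ℝ) 1))
    (hne : ∀ u ∈ Icc (0:ℝ) 1, A u ^ 2 + B u ^ 2 ≠ 0) :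
    ContinuousOn (fun y : ℝ => (((A y : ℝ) : ℂ) - ((B y : ℝ) : ℂ) * I) *
        exp (2 * ((T y : ℝ) : ℂ) * I) / (((A y : ℝ) : ℂ) + ((B y : ℝ) : ℂ) * I))
      (Icc (0:ℝ) 1) := by
  have hAc : ContinuousOn (fun y : ℝ => ((A y : ℝ) : ℂ)) (Icc (0:ℝ) 1) :=
    Complex.continuous_ofReal.comp_continuousOn hA
  have hBc : ContinuousOn (fun y : ℝ => ((B y : ℝ) : ℂ)) (Icc (0:ℝ) 1) :=
    Complex.continuous_ofReal.comp_continuousOn hB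
  refine ContinuousOn.div ?_ ?_ (fun u hu => loopAngle_point_ne_zero (hne u hu))
  · refine (hAc.sub (hBc.mul continuousOn_const)).mul ?_
    refine Complex.continuous_exp.comp_continuousOn ?_
    exact (continuousOn_const.mul (Complex.continuous_ofReal.comp_continuousOn hT)).mul
      continuousOn_const
  · exact hAc.add (hBc.mul continuousOn_const)

/-- The value at a rational point of `[0,1]` of a real function `ℚ`-semialgebraic on the unit cube
of `ℝ¹` lies in the field `ℚ̄ ∩ ℂ` of complex algebraic numbers (its complexification is
algebraic): values of `ℚ`-semialgebraic functions at algebraic points are algebraic.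
[folklore] -/
theorem saLoopAngle_apply_mem_algebraicClosure {f : ℝ → ℝ}
    (hf : IsSemialgebraicFunOn ℚ (Set.pi Set.univ (fun _ : Fin 1 => Set.Icc (0:ℝ) 1))
      (fun z => f (z 0)))
    {r : ℝ} (hr : r ∈ Icc (0:ℝ) 1) (halg : IsAlgebraic ℚ r) :
    ((f r : ℝ) : ℂ) ∈ algebraicClosure ℚ ℂ := by
  have e := hf.isAlgebraic_apply (a := fun _ => r) (fun _ _ => hr) fun _ => halg
  have h : IsAlgebraic ℚ ((f r : ℝ) : ℂ) := by
    simpa using e.algebraMap (A := ℂ)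
  exact mem_algebraicClosure_iff.mpr h

/-- **Registered stub `stub_saLoopAngleExp` (X3, rung 10 of the line `fibrewise_stokes`): the
exponential of the total angle of a semialgebraic `C¹` loop is algebraic.** For a complex loop
`P = A + iB` on `[0,1]`, `A, B` continuous on `[0,1]` and differentiable on `(0,1)` with
derivatives `A', B'` continuous on `[0,1]`, `A, B` `ℚ`-semialgebraic (so the endpoint values are
algebraic) and `P` without zeros on `[0,1]`, with total angle
`Θ = ∫₀¹ Im (P'/P) = ∫₀¹ (A B' − A' B)/(A² + B²)`, the number `e^{iΘ}` is algebraic: the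
rotating frame `conj(P) e^{2iT}/P` (`T` the angle primitive) is constant on `[0,1]`, whence
`e^{2iΘ} = conj(P(0)) P(1)/(P(0) conj(P(1))) ∈ ℚ̄`, and a square root of an algebraic number is
algebraic. [folklore] [cite: KontsevichZagier2001, §1.2] -/
theorem stub_saLoopAngleExp :
    ∀ (A B A' B' : ℝ → ℝ),
      IsSemialgebraicFunOn ℚ (Set.pi Set.univ (fun _ : Fin 1 => Set.Icc (0:ℝ) 1)) (fun z => A (z 0)) →
      IsSemialgebraicFunOn ℚ (Set.pi Set.univ (fun _ : Fin 1 => Set.Icc (0:ℝ) 1)) (fun z => B (z 0)) →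
      ContinuousOn A (Set.Icc (0:ℝ) 1) → ContinuousOn B (Set.Icc (0:ℝ) 1) →
      ContinuousOn A' (Set.Icc (0:ℝ) 1) → ContinuousOn B' (Set.Icc (0:ℝ) 1) →
      (∀ u ∈ Set.Ioo (0:ℝ) 1, HasDerivAt A (A' u) u) → (∀ u ∈ Set.Ioo (0:ℝ) 1, HasDerivAt B (B' u) u) →
      (∀ u ∈ Set.Icc (0:ℝ) 1, A u ^ 2 + B u ^ 2 ≠ 0) →
      IsAlgebraic ℚ (Complex.exp (((∫ u in (0:ℝ)..1, (A u * B' u - A' u * B u) / (A u ^ 2 + B u ^ 2) : ℝ) : ℂ) *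
        Complex.I)) := by
  intro A B A' B' hsA hsB hA hB hA' hB' hdA hdB hne
  set w : ℝ → ℝ := fun u => (A u * B' u - A' u * B u) / (A u ^ 2 + B u ^ 2) with hw_def
  set T : ℝ → ℝ := fun y => ∫ u in (0:ℝ)..y, w u with hT_def
  -- the angle primitive `T` and the rotating frame `conj(P) e^{2iT}/P`
  have hwc : ContinuousOn w (Icc (0:ℝ) 1) := saLoopAngle_integrand_continuousOn hA hB hA' hB' hne
  have hTc : ContinuousOn T (Icc (0:ℝ) 1) := loopAngle_primitive_continuousOn hwc
  have hgd : ∀ x ∈ Ioo (0:ℝ) 1,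
      HasDerivAt (fun y : ℝ => (((A y : ℝ) : ℂ) - ((B y : ℝ) : ℂ) * I) *
        exp (2 * ((T y : ℝ) : ℂ) * I) / (((A y : ℝ) : ℂ) + ((B y : ℝ) : ℂ) * I)) 0 x := by
    intro x hx
    have hxne := hne x (Ioo_subset_Icc_self hx)
    exact saLoopAngle_frame_hasDerivAt (hdA x hx) (hdB x hx) (loopAngle_primitive_hasDerivAt hwc hx)
      (div_mul_cancel₀ _ hxne) hxne
  have h10 := loopAngle_eq_of_hasDerivAt_zero (saLoopAngle_frame_continuousOn hA hB hTc hne) hgd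
  -- evaluate the frame at the endpoints: `e^{2iΘ} = conj(P(0)) P(1)/(P(0) conj(P(1)))`
  have hT0 : T 0 = 0 := intervalIntegral.integral_same
  simp only [hT0, Complex.ofReal_zero, mul_zero, zero_mul, Complex.exp_zero, mul_one] at h10
  have h0 : (0:ℝ) ∈ Icc (0:ℝ) 1 := ⟨le_rfl, zero_le_one⟩
  have h1 : (1:ℝ) ∈ Icc (0:ℝ) 1 := ⟨zero_le_one, le_rfl⟩
  have hP1 := loopAngle_point_ne_zero (hne 1 h1)
  have hQ1 := loopAngle_conjPoint_ne_zero (hne 1 h1)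
  have hE : exp (2 * ((T 1 : ℝ) : ℂ) * I) =
      (((A 0 : ℝ) : ℂ) - ((B 0 : ℝ) : ℂ) * I)
        / (((A 0 : ℝ) : ℂ) + ((B 0 : ℝ) : ℂ) * I)
        * (((A 1 : ℝ) : ℂ) + ((B 1 : ℝ) : ℂ) * I)
        / (((A 1 : ℝ) : ℂ) - ((B 1 : ℝ) : ℂ) * I) := by
    rw [← h10, div_mul_cancel₀ _ hP1, mul_div_cancel_left₀ _ hQ1]
  -- algebraicity: `i`, and the endpoint values of the semialgebraic `A`, `B`
  have hI : I ∈ algebraicClosure ℚ ℂ := mem_algebraicClosure_iff.mpr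
    (IsAlgebraic.of_pow two_pos (by rw [Complex.I_sq]; exact isAlgebraic_one.neg))
  have hA0 := saLoopAngle_apply_mem_algebraicClosure hsA h0 isAlgebraic_zero
  have hA1 := saLoopAngle_apply_mem_algebraicClosure hsA h1 isAlgebraic_one
  have hB0 := saLoopAngle_apply_mem_algebraicClosure hsB h0 isAlgebraic_zero
  have hB1 := saLoopAngle_apply_mem_algebraicClosure hsB h1 isAlgebraic_one
  have hmem : exp (2 * ((T 1 : ℝ) : ℂ) * I) ∈ algebraicClosure ℚ ℂ := by
    rw [hE]
    exact div_mem (mul_mem (div_mem (sub_mem hA0 (mul_mem hB0 hI))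
      (add_mem hA0 (mul_mem hB0 hI))) (add_mem hA1 (mul_mem hB1 hI)))
      (sub_mem hA1 (mul_mem hB1 hI))
  refine IsAlgebraic.of_pow two_pos (mem_algebraicClosure_iff.mp ?_)
  have hsq : exp (((T 1 : ℝ) : ℂ) * I) ^ 2 = exp (2 * ((T 1 : ℝ) : ℂ) * I) := by
    rw [sq, ← Complex.exp_add]
    ring_nf
  rw [hsq]
  exact hmem

end Summit.KontsevichZagierPeriods.KontsevichZagierPeriods.Cruxes.StokesGeneration.FibrewiseStokes

end
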